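import Summits.CriticalPhenomena.PercolationContinuityZ3.Theses.PercNearOneGluing
import Summits.CriticalPhenomena.PercolationContinuityZ3.Theses.PercNearOneGluingNoHeavy
import Summits.CriticalPhenomena.PercolationContinuityZ3.Theorems.PercNearOneGluingNoHeavyLowerTailGlue
import Summits.CriticalPhenomena.PercolationContinuityZ3.Theorems.PercNearOneGluingNoHeavyLowerTailCSHTheoremOne
import HarnessLib

/-!
# `NearOneGluing` (stmt-CriticalPhenomena-4574) — Kozma–Nitzan's Conjecture 3 over finite weighted graphs, PROVED

Closing file for the crux `NearOneGluing` (`X` itself) of the sibling routes `PercNearOneGluing`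
(registered crux decl) and `PercNearOneGluingNoHeavy` (sub-problem `PercolationContinuityZ3`):
for every `ε > 0` there is `δ > 0` such that, on every finite weighted graph
(`prodBernoulli w` on `Sym2 (Fin n)`), `P(o ↔ A) > 1 − δ` and `P(a ↔ b) > 1 − δ` for all `a ∈ A`
imply `P(o ↔ b) > 1 − ε`.

Proof (two tree theorems composed, no new mathematics in this file):

* the engine crux `NoHeavyLowerTail` (stmt-CriticalPhenomena-4575) is a theorem —
  `CSH.noHeavyLowerTail_holds` (prim-hp-8's conditioned-slack-hierarchy assembly
  `(S5)_r ⟹ AdditiveGluing ⟹ NoHeavyLowerTail`, file `…NoHeavyLowerTailCSHTheoremOne.lean`);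
* the glue `NoHeavyLowerTailGlue : NoHeavyLowerTail → NearOneGluing` (stmt-CriticalPhenomena-14716)
  is a theorem — `noHeavyLowerTailGlue_proof` (choice `δ = min (δ₀/2) (ε/3)`, pairwise reliability
  of `A` through `b` by the union bound, the cover
  `{o ↮ b} ⊆ {N = 0} ∪ {1 ≤ N < t} ∪ ({t ≤ N} ∩ {o ↮ b})` with `N = |C(o) ∩ A|`, and Harris + Markov
  on the last piece; file `…NoHeavyLowerTailSuffices.lean`).

The two route declarations `PercNearOneGluing.NearOneGluing` and `PercNearOneGluingNoHeavy.NearOneGluing`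
are syntactically identical, so the second theorem is the first read at the sibling type.
[cite: KozmaNitzan2024, Conjecture 3 (p. 15)]
-/

namespace Summit.CriticalPhenomena.PercolationContinuityZ3.Theorems

/-- **Kozma–Nitzan's Conjecture 3 over finite weighted graphs** — the crux `NearOneGluing` of route
`PercNearOneGluing` (stmt-CriticalPhenomena-4574, registered crux declaration): `∀ ε > 0 ∃ δ > 0`,
on every finite weighted graph `P(o ↔ A) > 1 − δ ∧ (∀ a ∈ A, P(a ↔ b) > 1 − δ) ⟹ P(o ↔ b) > 1 − ε`.
Proof: the proved engine `NoHeavyLowerTail` (`CSH.noHeavyLowerTail_holds`) fed to the proved glue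
`NoHeavyLowerTailGlue` (`noHeavyLowerTailGlue_proof`). [cite: KozmaNitzan2024, Conjecture 3 (p. 15)] -/
theorem NearOneGluing_proof :
    Summit.CriticalPhenomena.PercolationContinuityZ3.Theses.PercNearOneGluing.NearOneGluing :=
  noHeavyLowerTailGlue_proof CSH.noHeavyLowerTail_holds

/-- **The same crux at the type of the sibling route `PercNearOneGluingNoHeavy`** (its declaration
`NearOneGluing` is syntactically the one of `PercNearOneGluing`). [cite: KozmaNitzan2024, Conjecture 3 (p. 15)] -/
theorem NearOneGluing_proof' :
    Summit.CriticalPhenomena.PercolationContinuityZ3.Theses.PercNearOneGluingNoHeavy.NearOneGluing :=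
  NearOneGluing_proof

end Summit.CriticalPhenomena.PercolationContinuityZ3.Theorems
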